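import Summits.HubbardSuperconductivity.HubbardSuperconductivity.Theorems.LowEnergyRigidity.Negative.FalseWithoutRepulsion
import Summits.HubbardSuperconductivity.HubbardSuperconductivity.Theorems.BalabanIRBirEveryGroundStateSchur
import Literature.MathematicalPhysics.QuantumLattice.HubbardGrandCanonicalDensity

/-!
# `LowEnergyRigidity` (crux stmt-HubbardSuperconductivity-1892, route `DeformationLadder`):
# no witness `(κ, a, L₀)` survives uniformly as `U → 0⁺` (negative-side support, refuter
# crux-disprover seat)

`LowEnergyRigidity` claims: `∃ U>0, δ∈(0,½), κ>0, a>0, L₀, ∀ even L ≥ L₀`, every unit vector `φ` of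
`szSector N_L 0` with `Re⟨φ, H_L φ⟩ ≤ minEnergyOn H_L (szSector N_L 0) + κ`
(`H_L = hubbardTorus 2 L 1 U`) has `a ≤ L⁻⁴ Re⟨φ, Δ_dᴴΔ_d φ⟩`.

The companion file `FalseWithoutRepulsion` shows the matrix is false AT `U = 0`. Here we push this
into the open coupling range (statement inline; no proposition is defined under `Summits/`):

* `lowEnergyRigidity_false_uniformly_near_zero_coupling` — there are NO `δ > -1`, `κ > 0`, `a > 0`,
  `L₀` and `U₀ > 0` such that the matrix holds for EVERY `U ∈ (0, U₀)` at every even `L ≥ L₀`.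
  Proof: fix an even side `L ≥ max(L₀, 3)` with `aL² > 32` and the pair-poor FREE ground state `φ`
  there (`exists_unit_groundState_pairField_le_free`: `Re⟨φ, Δ_dᴴΔ_d φ⟩ ≤ 32L²`); then take the
  coupling `U = min(U₀/2, κ/L²)`. Since `H_U = H_0 + U Σ_x n_{x↑}n_{x↓}` with
  `0 ≤ Σ_x n_{x↑}n_{x↓} ≤ L²`, the sector ground energy is non-decreasing in `U` and
  `Re⟨φ, H_U φ⟩ ≤ E₀(0) + U L² ≤ E₀(U) + κ`: the free ground state sits inside the `κ`-window of the
  INTERACTING model, with LRO density `≤ 32/L² < a`.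

Moral for provers: in any witness `(U, δ, κ, a, L₀)` of the crux the triple `(κ, a, L₀)` must
degenerate as `U → 0⁺` — `κ(U) → 0`, or `a(U) → 0`, or `L₀(U) → ∞` (indeed `L₀(U)² ≳ κ/U` is forced
by this very argument: the free ground state stays in the window while `U L² ≤ κ`). Consistent with
the BCS picture (`L₀ ≳` coherence length, `a ∼ Δ²`), and a constraint every proof must reproduce.
This file does NOT refute the crux.

References: Bach–Lieb–Solovej, J. Stat. Phys. 76 (1994) 3, §2 (positivity of the on-site
repulsion); Tasaki (2020) §2.1 (variational principle); the tree's `FreeFermiGasNoPairFieldLRO`.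
-/

noncomputable section

set_option linter.dupNamespace false

namespace Summit.HubbardSuperconductivity.HubbardSuperconductivity.Theorems.LowEnergyRigidity.Negative

open Literature.MathematicalPhysics.QuantumLattice Matrix Literature.Barriers.HubbardSuperconductivity
open Summit.HubbardSuperconductivity.HubbardSuperconductivity.Theorems
open scoped ComplexOrder

/-- The pure torus Hamiltonians at couplings `U` and `0` differ by the repulsion alone:
`H_U = H_0 + U Σ_x n_{x↑} n_{x↓}`. [folklore] -/
theorem hubbardTorus_eq_free_add_smul_doubleOcc (L : ℕ) [NeZero L] (U : ℝ) :
    hubbardTorus 2 L 1 U = hubbardTorus 2 L 1 0 +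
      (U : ℂ) • ∑ x : FermionTorus 2 L, numberOp x 0 * numberOp x 1 := by
  have h := hamiltonianWith_sub_hamiltonianWith (fermionTorusGraph 2 L) 1 0 U 0
  rw [hamiltonianWith_zero, hamiltonianWith_zero, sub_zero] at h
  change hubbardTorus 2 L 1 U - hubbardTorus 2 L 1 0 = _ at h
  rw [sub_eq_iff_eq_add'] at h
  rw [h, add_comm]

section DoubleOccupancy

variable {Λ : Type*} [LinearOrder Λ] [Fintype Λ]

/-- The double occupancy of a unit vector is at most the number of sites:
`Re⟨φ, Σ_x n_{x↑}n_{x↓} φ⟩ ≤ |Λ|` (from the operator bound `Σ_x n_{x↑}n_{x↓} ≤ |Λ|·1`). Stated over a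
general `LinearOrder Λ` so that the `DecidableEq` instance hidden in `1` is the one of
`posSemidef_card_sub_sum_numberOp_mul_numberOp`. [folklore] -/
theorem re_doubleOcc_le_card {φ : Fock (Orb Λ)} (hφ1 : star φ ⬝ᵥ φ = 1) :
    (star φ ⬝ᵥ (∑ x : Λ, numberOp x 0 * numberOp x 1) *ᵥ φ).re ≤ Fintype.card Λ := by
  have h := (posSemidef_card_sub_sum_numberOp_mul_numberOp (Λ := Λ)).re_dotProduct_nonneg φ
  rw [sub_mulVec, dotProduct_sub, smul_mulVec, one_mulVec, dotProduct_smul, hφ1, smul_eq_mul,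
    mul_one] at h
  simp only [RCLike.re_to_complex, Complex.sub_re, Complex.natCast_re] at h
  linarith

/-- The double occupancy of any vector is nonnegative. [folklore] -/
theorem re_doubleOcc_nonneg (φ : Fock (Orb Λ)) :
    0 ≤ (star φ ⬝ᵥ (∑ x : Λ, numberOp x 0 * numberOp x 1) *ᵥ φ).re := by
  have h := (posSemidef_sum_numberOp_mul_numberOp (Λ := Λ)).re_dotProduct_nonneg φ
  simpa only [RCLike.re_to_complex] using h

end DoubleOccupancy

/-- On the torus of side `L`: `Re⟨φ, Σ_x n_{x↑}n_{x↓} φ⟩ ≤ L²` for a unit vector `φ`. [folklore] -/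
theorem re_doubleOcc_le_sq (L : ℕ) [NeZero L] {φ : Fock (Orb (FermionTorus 2 L))}
    (hφ1 : star φ ⬝ᵥ φ = 1) :
    (star φ ⬝ᵥ (∑ x : FermionTorus 2 L, numberOp x 0 * numberOp x 1) *ᵥ φ).re ≤ (L : ℝ) ^ 2 := by
  have h := re_doubleOcc_le_card (Λ := FermionTorus 2 L) hφ1
  rw [card_fermionTorus 2] at h
  push_cast at h
  exact h

/-- **The sector ground energy is non-decreasing in the repulsion** (`0 ≤ U`, any sector containing
a unit vector): `minEnergyOn H_0 K ≤ minEnergyOn H_U K`. [folklore] -/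
theorem minEnergyOn_free_le_minEnergyOn (L : ℕ) [NeZero L] {U : ℝ} (hU : 0 ≤ U)
    (K : Submodule ℂ (Fock (Orb (FermionTorus 2 L))))
    (hK : ∃ ψ ∈ K, star ψ ⬝ᵥ ψ = 1) :
    (hubbardTorus 2 L 1 0).minEnergyOn K ≤ (hubbardTorus 2 L 1 U).minEnergyOn K := by
  obtain ⟨ψ₀, hψ₀K, hψ₀⟩ := hK
  refine le_csInf ⟨_, ψ₀, hψ₀K, hψ₀, rfl⟩ ?_
  rintro E ⟨ψ, hψK, hψ1, rfl⟩
  rw [hubbardTorus_eq_free_add_smul_doubleOcc L U, add_mulVec, dotProduct_add, Complex.add_re,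
    smul_mulVec, dotProduct_smul, smul_eq_mul, Complex.re_ofReal_mul]
  have h1 := minEnergyOn_le_re_rayleigh (hubbardTorus 2 L 1 0) K hψK hψ1
  have h2 := mul_nonneg hU (re_doubleOcc_nonneg ψ)
  linarith

/-- **No witness of the crux survives uniformly as `U → 0⁺`.** There are no `δ > -1`, `κ > 0`,
`a > 0`, `L₀` and `U₀ > 0` such that the matrix of `LowEnergyRigidity` holds for every
`U ∈ (0, U₀)` at every even side `L ≥ L₀`: at an even side `L ≥ max(L₀, 3)` with `aL² > 32`, the
pair-poor free ground state (`Re⟨Δ_dᴴΔ_d⟩ ≤ 32L²`) lies inside the `κ`-window of `H_U` for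
`U = min(U₀/2, κ/L²)` (`Re⟨φ, H_U φ⟩ ≤ E₀(0) + UL² ≤ E₀(U) + κ`), yet its LRO density is
`≤ 32/L² < a`. Hence `(κ, a, L₀)(U)` must degenerate as `U → 0⁺` (`L₀(U)² ≳ κ(U)/U` whenever
`a(U)` stays bounded below). Bach–Lieb–Solovej (1994) §2; Tasaki (2020) §2.1. [folklore] -/
theorem lowEnergyRigidity_false_uniformly_near_zero_coupling :
    ¬ ∃ δ : ℝ, -1 < δ ∧ ∃ κ : ℝ, 0 < κ ∧ ∃ a : ℝ, 0 < a ∧ ∃ L₀ : ℕ, ∃ U₀ : ℝ, 0 < U₀ ∧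
      ∀ U ∈ Set.Ioo (0 : ℝ) U₀, ∀ (L : ℕ) [NeZero L], L₀ ≤ L → Even L →
      ∀ φ : Fock (Orb (FermionTorus 2 L)),
        φ ∈ szSector (2 * ⌊(1 - δ) * (L : ℝ) ^ 2 / 2⌋₊) 0 → star φ ⬝ᵥ φ = 1 →
        (star φ ⬝ᵥ Matrix.mulVec (hubbardTorus 2 L 1 U) φ).re ≤
          (hubbardTorus 2 L 1 U).minEnergyOn (szSector (2 * ⌊(1 - δ) * (L : ℝ) ^ 2 / 2⌋₊) 0) + κ →
        a ≤ (expect ((pairField dWaveFormFactor L)ᴴ * pairField dWaveFormFactor L) φ).re /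
          (L : ℝ) ^ 4 := by
  rintro ⟨δ, hδ, κ, hκ, a, ha, L₀, U₀, hU₀, h⟩
  -- an even side `L ≥ max(L₀, 3)` with `a L² > 32`
  set M : ℕ := ⌈32 / a⌉₊ with hM
  set L : ℕ := 2 * (max L₀ M + 2) with hLdef
  have hL0 : L₀ ≤ L := by have := le_max_left L₀ M; omega
  have hLM : M + 1 ≤ L := by have := le_max_right L₀ M; omega
  have hL3 : 3 ≤ L := by omega
  haveI : NeZero L := ⟨by omega⟩
  have hev : Even L := even_two_mul _
  have hLreal : 32 / a < (L : ℝ) := by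
    have h1 : 32 / a ≤ (M : ℝ) := Nat.le_ceil _
    have h2 : (M : ℝ) + 1 ≤ L := by exact_mod_cast hLM
    linarith
  have hL1 : (1 : ℝ) ≤ L := by exact_mod_cast (show 1 ≤ L by omega)
  have haL : 32 < a * (L : ℝ) ^ 2 := by
    have h1 : 32 < a * L := by
      rw [div_lt_iff₀ ha] at hLreal; linarith
    nlinarith
  have hL2 : (0 : ℝ) < (L : ℝ) ^ 2 := by positivity
  -- the pair-poor free ground state at this side
  obtain ⟨φ, hφS, hφ1, hφeig, hφY⟩ :=
    exists_unit_groundState_pairField_le_free L hL3 (natFloor_filling_le_sq hδ.le L)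
  -- the coupling `U = min (U₀/2) (κ/L²)`
  set U : ℝ := min (U₀ / 2) (κ / (L : ℝ) ^ 2) with hUdef
  have hUpos : 0 < U := lt_min (by positivity) (by positivity)
  have hUlt : U < U₀ := (min_le_left _ _).trans_lt (by linarith)
  have hUL : U * (L : ℝ) ^ 2 ≤ κ := by
    have := min_le_right (U₀ / 2) (κ / (L : ℝ) ^ 2)
    rw [← hUdef, le_div_iff₀ hL2] at this
    exact this
  -- the free ground state is inside the `κ`-window of `H_U`
  set S := szSector (Λ := FermionTorus 2 L) (2 * ⌊(1 - δ) * (L : ℝ) ^ 2 / 2⌋₊) 0 with hSdef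
  have hE0 : (star φ ⬝ᵥ (hubbardTorus 2 L 1 0) *ᵥ φ).re = (hubbardTorus 2 L 1 0).minEnergyOn S := by
    rw [hφeig, dotProduct_smul, hφ1, smul_eq_mul, mul_one, Complex.ofReal_re]
  have hmono := minEnergyOn_free_le_minEnergyOn L hUpos.le S ⟨φ, hφS, hφ1⟩
  have hEU : (star φ ⬝ᵥ Matrix.mulVec (hubbardTorus 2 L 1 U) φ).re =
      (hubbardTorus 2 L 1 0).minEnergyOn S +
        U * (star φ ⬝ᵥ (∑ x : FermionTorus 2 L, numberOp x 0 * numberOp x 1) *ᵥ φ).re := by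
    rw [hubbardTorus_eq_free_add_smul_doubleOcc L U, add_mulVec, dotProduct_add, Complex.add_re,
      smul_mulVec, dotProduct_smul, smul_eq_mul, Complex.re_ofReal_mul, hE0]
  have hwin : (star φ ⬝ᵥ Matrix.mulVec (hubbardTorus 2 L 1 U) φ).re ≤
      (hubbardTorus 2 L 1 U).minEnergyOn S + κ := by
    rw [hEU]
    have hD := re_doubleOcc_le_sq L hφ1
    have : U * (star φ ⬝ᵥ (∑ x : FermionTorus 2 L, numberOp x 0 * numberOp x 1) *ᵥ φ).re ≤ κ :=
      (mul_le_mul_of_nonneg_left hD hUpos.le).trans hUL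
    linarith
  have hLRO := h U ⟨hUpos, hUlt⟩ L hL0 hev φ hφS hφ1 hwin
  -- but its LRO density is `≤ 32/L² < a`
  have hL4 : (0 : ℝ) < (L : ℝ) ^ 4 := by positivity
  simp only [Literature.MathematicalPhysics.QuantumLattice.expect] at hLRO
  rw [le_div_iff₀ hL4] at hLRO
  have : a * (L : ℝ) ^ 4 ≤ 32 * (L : ℝ) ^ 2 := hLRO.trans hφY
  nlinarith

end Summit.HubbardSuperconductivity.HubbardSuperconductivity.Theorems.LowEnergyRigidity.Negative

end
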